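import Summits.BirchSwinnertonDyer.BirchSwinnertonDyer.Theorems.BiquadraticEisensteinDescentEisensteinDivisibilityCMInertBadFlatAtOneStubEa
import Summits.BirchSwinnertonDyer.Rank1Residual.X11b.UnrSeriesIdealEqualityDescent
import HarnessLib

set_option linter.dupNamespace false -- `Summit.BirchSwinnertonDyer.BirchSwinnertonDyer.Theorems.…` (summit = sub)
set_option autoImplicit false

/-!
# Crux (E♭°) `EisensteinDivisibilityCMInertBadFlatAtOne` (stmt-BirchSwinnertonDyer-20452), line `birth`:
# the ∀-frame stubs `stub_E1B` / `stub_E2` do not see the frame — two `R₀`-frames of one datum generate the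
# SAME ideal of `R₀⟦T⟧`, so divisibility up to `p^m` (and `p ∤ L`) for ONE `R₀`-frame gives it for ALL

Route `BiquadraticEisensteinDescent` (cell `pub/bsd-wall`, lead-prover seat `bsd-wall-bed-p1`, g2; skeleton v3, stubs
`stub_E0` / `stub_E1B` / `stub_E2`). The registered heart `stub_E1B` is typed for EVERY `R₀`-frame `L` of the datum
(`IsBDPLFunction ι′ 𝔭 κ γ f Ω_K′ Ω_p L`, any periods): `∃ m, p^m · Ch(X_𝔭′)·R₀⟦T⟧ ⊆ (L)`. Its eventual prover will
produce ONE object (the anticyclotomic Katz line of `L = K_CM·K′`). This file supplies the transfer: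

* `span_eq_span_of_isBDPLFunction` — for `p` odd, `K` imaginary quadratic, `κ` anticyclotomic with topological
  generator `γ`: two `R₀`-frames `L, L'` of the same `(ι, 𝔭, κ, γ, f)` (non-zero periods) have
  `Ideal.span {L'} = Ideal.span {L}` in `R₀⟦T⟧` — the `𝓞_{ℂ_p}⟦T⟧`-equality of the landed helper
  `…FlatAtOneStubEa.span_map_eq_span_map_of_isBDPLFunction` (ideal rigidity across periods) DESCENDED by cell
  b2b-bsdres's `X11b.ideal_eq_span_singleton_of_map_eq_span` (`UnrSeriesIdealEqualityDescent.lean`).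
* `forall_frame_pow_mul_mem_span_of_exists` — hence, for any ideal `J ⊆ Λ = ℤ_p⟦T⟧`: if SOME `R₀`-frame `L₀`
  (`Ω_K₀ ≠ 0`, `Ω_p₀ ∈ R₀ˣ`) has `∃ m, ∀ x ∈ J·R₀⟦T⟧, p^m·x ∈ (L₀)`, then EVERY `R₀`-frame `L` (`Ω_K ≠ 0`,
  `Ω_p ∈ R₀ˣ`) has it (same `m`); `forall_frame_not_C_dvd_of_exists` — likewise for `p ∤ L`.
  With `J = XAc.charIdeal (W.baseChange K′) p κ 𝔭′ ∅ γ` these turn the ∃-form of `stub_E1B` / `stub_E2` for the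
  one Katz object into the registered ∀-forms.

THEOREMS ONLY (no definition, no named fact, no `sorry`); imports no `Theses` module; nothing about existence of
frames, the divisibility itself, or any case of BSD is asserted. Supports, does not close, stmt-BirchSwinnertonDyer-20452.

References: [Castella2018] Thm. 3.1, §2.2, §3 (arXiv:1704.06608 pp. 5, 9); [CastellaHsieh2018] §3.3.
-/

noncomputable section

open scoped Classical

open PowerSeries NumberField IsDedekindDomain Field
  Literature.NumberTheory.EllipticCurves Literature.NumberTheory.GaloisRepresentations
  Summit.BirchSwinnertonDyer.Rank1Residual.X11b Summit.BirchSwinnertonDyer.Rank1Residual.X11b.Halves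
  Summit.BirchSwinnertonDyer.BirchSwinnertonDyer.Theorems.BiquadraticEisensteinDescentEisensteinDivisibilityCMInertBadFlatAtOneStubEa

namespace Summit.BirchSwinnertonDyer.BirchSwinnertonDyer.Theorems.BiquadraticEisensteinDescentEisensteinDivisibilityCMInertBadFlatAtOneStubE1BOfOne

variable {p : ℕ} [Fact p.Prime] {K : Type} [Field K] [NumberField K] {N : ℕ}
  {ι : PadicAlgCl p ≃+* ℂ} {𝔭 : HeightOneSpectrum (𝓞 K)} {κ : ZpExtension K p}
  {γ : Field.absoluteGaloisGroup K} {f : CuspForm (CongruenceSubgroup.Gamma0 N) 2}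

/-- **Two `R₀`-frames of one datum generate the same ideal of `R₀⟦T⟧`.** For `p` odd, `K` imaginary quadratic,
`κ` anticyclotomic with topological generator `γ`: `IsBDPLFunction ι 𝔭 κ γ f Ω_K Ω_p L` and
`IsBDPLFunction ι 𝔭 κ γ f Ω_K' Ω_p' L'` with non-zero periods give `Ideal.span {L'} = Ideal.span {L}` in `R₀⟦T⟧`
(ideal rigidity across periods in `𝓞_{ℂ_p}⟦T⟧`, then equality descent `X11b.ideal_eq_span_singleton_of_map_eq_span`).
[cite: Castella2018, Thm. 3.1 and §3 (arXiv:1704.06608 p. 9)] -/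
theorem span_eq_span_of_isBDPLFunction (hp2 : p ≠ 2) (hK : IsImaginaryQuadratic K)
    (hκ : κ.IsAnticyclotomic) (hγ : κ.IsTopGenerator γ)
    {ΩK ΩK' : ℂ} {Ωp Ωp' : ℂ_[p]} {L L' : UnrSeries p}
    (hΩK : ΩK ≠ 0) (hΩK' : ΩK' ≠ 0) (hΩp : Ωp ≠ 0) (hΩp' : Ωp' ≠ 0)
    (hL : IsBDPLFunction ι 𝔭 κ γ f ΩK Ωp L) (hL' : IsBDPLFunction ι 𝔭 κ γ f ΩK' Ωp' L') :
    Ideal.span ({L'} : Set (UnrSeries p)) = Ideal.span {L} := by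
  refine ideal_eq_span_singleton_of_map_eq_span ?_
  rw [Ideal.map_span, Set.image_singleton]
  exact span_map_eq_span_map_of_isBDPLFunction hp2 hK hκ hγ hΩK hΩK' hΩp hΩp' hL hL'

/-- **Divisibility up to `p^m` transfers from ONE `R₀`-frame to EVERY `R₀`-frame.** For any ideal `J` of
`Λ = ℤ_p⟦T⟧` (e.g. `Ch_Λ(X_ac)`), `p` odd, `K` imaginary quadratic, `κ` anticyclotomic with generator `γ`: if some
`R₀`-frame `L₀` (`Ω_K₀ ≠ 0`, `Ω_p₀ ∈ R₀ˣ`) satisfies `∀ x ∈ J·R₀⟦T⟧, p^m·x ∈ (L₀)`, then so does every `R₀`-frame `L`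
(`Ω_K ≠ 0`, `Ω_p ∈ R₀ˣ`) of the same `(ι, 𝔭, κ, γ, f)`, with the same `m` (`(L) = (L₀)`).
[cite: Castella2018, Thm. 3.1 and §3 (arXiv:1704.06608 p. 9)] -/
theorem forall_frame_pow_mul_mem_span_of_exists (hp2 : p ≠ 2) (hK : IsImaginaryQuadratic K)
    (hκ : κ.IsAnticyclotomic) (hγ : κ.IsTopGenerator γ) (J : Ideal (IwasawaAlgebra p))
    (hex : ∃ (ΩK₀ : ℂ) (Ωp₀ : (unrIntegers p)ˣ) (L₀ : UnrSeries p), ΩK₀ ≠ 0 ∧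
      IsBDPLFunction ι 𝔭 κ γ f ΩK₀ ((Ωp₀ : unrIntegers p) : ℂ_[p]) L₀ ∧
      ∃ m : ℕ, ∀ x ∈ J.map (PowerSeries.map (toUnr p)),
        (PowerSeries.C ((p : ℕ) : unrIntegers p) : UnrSeries p) ^ m * x ∈ Ideal.span {L₀})
    {ΩK : ℂ} {Ωp : (unrIntegers p)ˣ} {L : UnrSeries p} (hΩK : ΩK ≠ 0)
    (hL : IsBDPLFunction ι 𝔭 κ γ f ΩK ((Ωp : unrIntegers p) : ℂ_[p]) L) :
    ∃ m : ℕ, ∀ x ∈ J.map (PowerSeries.map (toUnr p)),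
      (PowerSeries.C ((p : ℕ) : unrIntegers p) : UnrSeries p) ^ m * x ∈ Ideal.span {L} := by
  obtain ⟨ΩK₀, Ωp₀, L₀, hΩK₀, hL₀, m, hm⟩ := hex
  refine ⟨m, fun x hx ↦ ?_⟩
  rw [span_eq_span_of_isBDPLFunction hp2 hK hκ hγ hΩK₀ hΩK (coe_units_unrIntegers_ne_zero Ωp₀)
    (coe_units_unrIntegers_ne_zero Ωp) hL₀ hL]
  exact hm x hx

/-- **`p ∤ L` transfers from ONE `R₀`-frame to EVERY `R₀`-frame** (same setting): if some `R₀`-frame `L₀` has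
`p ∤ L₀` then every `R₀`-frame `L` of the datum has `p ∤ L` (`(L) = (L₀)`, so `L ∣ L₀`).
[cite: Castella2018, Thm. 3.1 and §3 (arXiv:1704.06608 p. 9)] -/
theorem forall_frame_not_C_dvd_of_exists (hp2 : p ≠ 2) (hK : IsImaginaryQuadratic K)
    (hκ : κ.IsAnticyclotomic) (hγ : κ.IsTopGenerator γ)
    (hex : ∃ (ΩK₀ : ℂ) (Ωp₀ : (unrIntegers p)ˣ) (L₀ : UnrSeries p), ΩK₀ ≠ 0 ∧
      IsBDPLFunction ι 𝔭 κ γ f ΩK₀ ((Ωp₀ : unrIntegers p) : ℂ_[p]) L₀ ∧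
      ¬ ((PowerSeries.C ((p : ℕ) : unrIntegers p) : UnrSeries p) ∣ L₀))
    {ΩK : ℂ} {Ωp : (unrIntegers p)ˣ} {L : UnrSeries p} (hΩK : ΩK ≠ 0)
    (hL : IsBDPLFunction ι 𝔭 κ γ f ΩK ((Ωp : unrIntegers p) : ℂ_[p]) L) :
    ¬ ((PowerSeries.C ((p : ℕ) : unrIntegers p) : UnrSeries p) ∣ L) := by
  obtain ⟨ΩK₀, Ωp₀, L₀, hΩK₀, hL₀, hndvd⟩ := hex
  intro hdvd
  apply hndvd
  have hmem : L₀ ∈ Ideal.span ({L} : Set (UnrSeries p)) := by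
    rw [← span_eq_span_of_isBDPLFunction hp2 hK hκ hγ hΩK hΩK₀ (coe_units_unrIntegers_ne_zero Ωp)
      (coe_units_unrIntegers_ne_zero Ωp₀) hL hL₀]
    exact Ideal.mem_span_singleton_self L₀
  exact dvd_trans hdvd (Ideal.mem_span_singleton.mp hmem)

end Summit.BirchSwinnertonDyer.BirchSwinnertonDyer.Theorems.BiquadraticEisensteinDescentEisensteinDivisibilityCMInertBadFlatAtOneStubE1BOfOne

end
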